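import Summits.HodgeConjecture.HodgeConjecture.Theorems.Ring2HypothesesDescentMotivatedOperators
import Summits.HodgeConjecture.HodgeConjecture.Theorems.Ring2HypothesesDescentMotivatedStarStable
import HarnessLib

/-!
# Ring 2 hypotheses, descent face — ANDRÉ'S PROPOSITION 2.2 IN OPERATOR FORM: the Lefschetz projections and
# the Lefschetz involution `*_η` are given by MOTIVATED correspondences

research route conditional on HC_CM; not a corollary; Q11.4-sentence-2 already refuted in dim ≥ 3.
Cell `pub-hodge-ring2` (Hodge ladder STAGE 3), seat `ring2-b05` (binder row b05
`Ring2.Hypotheses.MotivatedImpliesAlgebraicAV`), gen 36. `HC_CM` (`Theses.RankFourFaces.CMAbelianHodge`) does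
not occur in this file; nothing here proves a case of the Hodge conjecture; the row b05 stays OPEN.

André 1996, Prop. 2.2 (p. 16): «Pour tout `X` polarisé dans `𝒱`, les opérateurs `*_L`, `Λ`, `ᶜΛ`, `p^j`, … sont
donnés par des correspondances motivées» — proof: «il suffit de montrer que pour tout `i ≤ d`, il existe un élément
de `C_mot(X, X)` induisant l'inverse de `L^{d-i}` sur `L^{d-i}Pⁱ(X)` … On conclut par [Kl68] 1.4.4, 1.4.6». Gen 36
(this seat) proved the engine `exists_corrClassAction_star_lefschetzPowTo_eq_smul` (`…StringTop`): the MOTIVATED class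
`u_l = *_Θ(Δ_* Lˡ 1)`, `Θ = η ⊞ η`, acts on the top `Lˡ Pⁱ` (`i + l = n`) of the strings of primitive degree `i` as
`p ↦ λ_p • p`, `λ_p ≠ 0`, and derived Cor. 1–2 at the level of CLASSES. This file carries out Kleiman's induction
[Kl68, 1.4.4–1.4.6] at the level of OPERATORS, in the algebra of operators induced by motivated correspondence classes
(`…Operators`: composition, Lefschetz twists; written as the image submodules
`(motivatedClasses (n + n) (X ⊗ X) e).map (corrAction μ hX hX hab)`, no new definition):

* §1 `exists_forall_eq_smul_of_forall` — linear algebra: an endomorphism for which every vector of a subspace is an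
  eigenvector is a scalar on that subspace; hence (§2, `exists_stringTop_mem_map_corrAction`) `u_l^* ∘ Lˡ = c • id`
  on `Pⁱ` with ONE `c ≠ 0`.
* §3 **`internalProj_lefschetzSummand_mem_map_corrAction`** — for every degree `a` and every Lefschetz index
  `P = (i, t)`, `i + 2t = a`, the projection `π_P : Hᵃ → Lᵗ Pⁱ ⊆ Hᵃ` of the Lefschetz decomposition
  `Hᵃ = ⊕ Lᵗ Pⁱ` is induced by a motivated class of codimension `n` on `X ⊗ X` (strong induction on `i`:
  `π_{(i,t)} = c⁻¹ · Lᵗ ∘ u_l^* ∘ (Lᵐ − Σ_{i' < i} π_{(i', ·)} ∘ Lᵐ)`, `t + m = l`, `i + l = n`; primitive degrees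
  `> i` die past the top of their strings, degrees `< i` are removed by the previous projections).
* §4 **`lefschetzInvolution_mem_map_corrAction` — PROP. 2.2 for `*_L`: for every smooth projective `X`, every
  polarisation class `η` and `a + b = 2n`, André's `*_η : Hᵃ(X(ℂ); ℂ) → Hᵇ(X(ℂ); ℂ)` is induced by a MOTIVATED class
  of codimension `b` on `X ⊗ X`** (`*_η = Σ_P c_P⁻¹ · Lˢ ∘ u^* ∘ Lˢ ∘ π_P`, `P = (i, j)`, `i + j + s = n`).

Consequences for the dictionary (parent node `MotivatedImpliesAlgebraic` ⟺ `B` for all varieties, b10) are drawn in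
the companion file `…MotivatedStarOperatorEdges`. No definition, no named fact, no sorry. References: Andre1996Motifs
(Prop. 2.2 p. 16, §2.1 Déf. 2 / Corollaire p. 15), Kleiman1968AlgebraicCycles (§1.4, 1.4.4–1.4.6; 2A11),
VoisinHodgeI2002 (§6.2.3 Cor. 6.26), Fulton1998 (§16.1).
-/

noncomputable section

-- every declaration of this problem lives in `Summit.HodgeConjecture.HodgeConjecture.…` (summit = sub-problem)
set_option linter.dupNamespace false

open CategoryTheory AlgebraicGeometry MonoidalCategory CartesianMonoidalCategory
open Literature.AlgebraicTopology.SingularHomology Literature.Geometry.Kaehler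
open Literature.AlgebraicGeometry Literature.AlgebraicGeometry.Motives
  Literature.AlgebraicGeometry.HodgeTheory

namespace Summit.HodgeConjecture.HodgeConjecture.Theorems

/-! ## §1 Linear algebra: every vector an eigenvector ⟹ a scalar -/

/-- **An endomorphism for which every vector of a subspace `P` is an eigenvector acts on `P` by ONE scalar**: if
`f p ∈ K · p` for every `p ∈ P` then `f|_P = c • id` for some `c` (for `p₀ ≠ 0` with `f p₀ = c₀ p₀` and any `p ∈ P`:
either `p ∈ K · p₀`, or `p₀, p` are independent and `f(p₀ + p) = c'(p₀ + p)` forces `c_p = c' = c₀`). [folklore] -/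
theorem exists_forall_eq_smul_of_forall {K V : Type*} [Field K] [AddCommGroup V] [Module K V] (P : Submodule K V)
    (f : V →ₗ[K] V) (hf : ∀ p ∈ P, ∃ c : K, f p = c • p) : ∃ c : K, ∀ p ∈ P, f p = c • p := by
  by_cases hP : ∀ p ∈ P, p = 0
  · exact ⟨0, fun p hp ↦ by rw [hP p hp, map_zero, smul_zero]⟩
  push Not at hP
  obtain ⟨p₀, hp₀, hp₀0⟩ := hP
  obtain ⟨c₀, hc₀⟩ := hf p₀ hp₀
  refine ⟨c₀, fun p hp ↦ ?_⟩
  by_cases hmem : p ∈ K ∙ p₀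
  · obtain ⟨r, rfl⟩ := Submodule.mem_span_singleton.mp hmem
    rw [map_smul, hc₀, smul_comm]
  obtain ⟨c₁, hc₁⟩ := hf p hp
  obtain ⟨c₂, hc₂⟩ := hf (p₀ + p) (P.add_mem hp₀ hp)
  rw [map_add, hc₀, hc₁, smul_add] at hc₂
  -- `(c₀ - c₂) • p₀ = (c₂ - c₁) • p`
  have key : (c₀ - c₂) • p₀ = (c₂ - c₁) • p := by
    rw [sub_smul, sub_smul, sub_eq_sub_iff_add_eq_add, hc₂, add_comm]
  have h21 : c₂ - c₁ = 0 := by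
    by_contra hne
    apply hmem
    refine Submodule.mem_span_singleton.mpr ⟨(c₂ - c₁)⁻¹ * (c₀ - c₂), ?_⟩
    rw [mul_smul, key, ← mul_smul, inv_mul_cancel₀ hne, one_smul]
  rw [h21, zero_smul, smul_eq_zero] at key
  have h02 : c₀ - c₂ = 0 := key.resolve_right hp₀0
  rw [hc₁, show c₁ = c₀ by rw [← sub_eq_zero.mp h21, ← sub_eq_zero.mp h02]]

variable {n : ℕ} {X : SchemeOver ℂ} {η : complexBetti X 2}

/-! ## §2 The string-top operator `u_l^* = [*_Θ(Δ_* Lˡ 1)]_*` with a uniform constant -/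

/-- **The motivated operator inverting `Lˡ` on the string tops `Lˡ Pⁱ`, uniform constant** (André Prop. 2.2, first
step; `…StringTop` + §1): for `X` smooth projective of dimension `n`, a polarisation class `η`, `i + l = n` and any
orientation family `μ`, there are an operator `T : H^{i+2l}(X(ℂ)) → Hⁱ(X(ℂ))` induced by a MOTIVATED class of
codimension `i` on `X ⊗ X` (namely `[*_Θ(Δ_* Lˡ 1)]_*`, `Θ = fst^* η + snd^* η`) and ONE scalar `c ≠ 0` with
`T (Lˡ p) = c • p` for every primitive `p ∈ Pⁱ`. [cite: Andre1996Motifs, Prop. 2.2 (p. 16)]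
[cite: Kleiman1968AlgebraicCycles, §1.4 (1.4.4–1.4.6)] -/
theorem exists_stringTop_mem_map_corrAction (μ : OrientationFamily) (hX : IsSmoothProjective n X)
    (hη : IsPolarizationClass n X η) {i l a : ℕ} (hil : i + l = n) (ha : i + 2 * l = a)
    (hab : a + 2 * i = i + 2 * n) :
    ∃ T ∈ (motivatedClasses (n + n) (X ⊗ X) i).map (corrAction μ hX hX hab), ∃ c : ℂ, c ≠ 0 ∧
      ∀ p ∈ primitiveClasses η n i, T (lefschetzPowTo η l i a ha p) = c • p := by
  have hL : HasHardLefschetzProperty η n := hη.hasHardLefschetz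
  have hXX : IsSmoothProjective (n + n) (X ⊗ X) := IsSmoothProjective.tensor_holds hX hX
  have hΘ := isPolarizationClass_boxSum hX hX hη hη
  have hμF : μ.HasPoincareDuality := OrientationFamily.hasPoincareDuality μ
  have hμ : (μ hXX).HasPoincareDuality := hμF hXX
  have hν : (μ hX).HasPoincareDuality := hμF hX
  -- the class `u = *_Θ(Δ_* Lˡ 1)` is motivated
  have hz : lefschetzPowTo η l 0 (2 * l) (Nat.zero_add _) (singularCohomology.one ℂ (ComplexPoints X)) ∈
      algebraicClasses X l :=
    lefschetzPowTo_one_mem_algebraicClasses_of_mem hX hη.mem_algebraicClasses l _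
  have hcalg : gysinMap (μ hX) (μ hXX) (AlgPoints.mapContinuous (L := ℂ) (lift (𝟙 X) (𝟙 X)))
      (show 2 * l + 2 * i = 2 * n by omega) (show 2 * (n + l) + 2 * i = 2 * (n + n) by omega)
      (lefschetzPowTo η l 0 (2 * l) (Nat.zero_add _) (singularCohomology.one ℂ (ComplexPoints X))) ∈
      algebraicClasses (X ⊗ X) (n + l) :=
    gysinMap_mem_algebraicClasses_of_isSmoothProjective hX hXX _ _ hμ (lift (𝟙 X) (𝟙 X)) _ _ (by omega) hz
  have hu := lefschetzInvolution_mem_motivatedClasses hXX hΘ (show n + l + i = n + n by omega)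
    (show 2 * (n + l) + 2 * i = 2 * (n + n) by omega) hcalg
  have hq : i + a = 2 * n := by omega
  refine ⟨corrAction μ hX hX hab _, Submodule.mem_map_of_mem hu, ?_⟩
  -- pointwise version with a constant depending on `p` (`…StringTop`)
  have key : ∀ p ∈ primitiveClasses η n i, ∃ c : ℂ, c ≠ 0 ∧
      corrAction μ hX hX hab
          (lefschetzInvolution hΘ.hasHardLefschetz (show 2 * (n + l) + 2 * i = 2 * (n + n) by omega)
            (gysinMap (μ hX) (μ hXX) (AlgPoints.mapContinuous (L := ℂ) (lift (𝟙 X) (𝟙 X)))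
              (show 2 * l + 2 * i = 2 * n by omega) (show 2 * (n + l) + 2 * i = 2 * (n + n) by omega)
              (lefschetzPowTo η l 0 (2 * l) (Nat.zero_add _) (singularCohomology.one ℂ (ComplexPoints X)))))
          (lefschetzPowTo η l i a ha p) = c • p := by
    intro p hp
    obtain ⟨c, hc, h⟩ := exists_corrClassAction_star_lefschetzPowTo_eq_smul hX hL hΘ.hasHardLefschetz (μ hXX) (μ hX)
      hμ hν hil ha (Nat.zero_add _) (by omega) (show a + a = 2 * (n + l) by omega) (by omega) hab hq hp
    refine ⟨c, hc, ?_⟩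
    rw [corrAction_eq_corrClassAction μ hX hX hab hq]
    exact h
  -- one constant for all of `Pⁱ`
  obtain ⟨c, hc⟩ := exists_forall_eq_smul_of_forall (primitiveClasses η n i) (corrAction μ hX hX hab _ ∘ₗ
    lefschetzPowTo η l i a ha) (fun p hp ↦ by
      obtain ⟨c, -, h⟩ := key p hp
      exact ⟨c, by rw [LinearMap.comp_apply, h]⟩)
  by_cases hbot : ∀ p ∈ primitiveClasses η n i, p = 0
  · exact ⟨1, one_ne_zero, fun p hp ↦ by rw [hbot p hp, map_zero, map_zero, smul_zero]⟩
  push Not at hbot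
  obtain ⟨p₀, hp₀, hp₀0⟩ := hbot
  refine ⟨c, ?_, fun p hp ↦ by rw [← hc p hp, LinearMap.comp_apply]⟩
  obtain ⟨c₀, hc₀0, hc₀⟩ := key p₀ hp₀
  have h := hc p₀ hp₀
  rw [LinearMap.comp_apply, hc₀] at h
  intro hc0
  rw [hc0, zero_smul, smul_eq_zero] at h
  exact hc₀0 (h.resolve_right hp₀0)

/-! ## §3 The Lefschetz projections are motivated operators (Kleiman's induction) -/

/-- **The projections of the Lefschetz decomposition are given by motivated correspondences** (André Prop. 2.2 for
the `p`-operators; Kleiman 1.4.4–1.4.6): for `X` smooth projective of dimension `n`, a polarisation class `η`, a degree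
`a` and a Lefschetz index `P = (i, t)` (`i + 2t = a`), the projection `π_P` of `Hᵃ(X(ℂ); ℂ) = ⊕_{(i,t)} Lᵗ Pⁱ` onto
`Lᵗ Pⁱ` is `[u]_*` for a MOTIVATED `u ∈ A_motⁿ(X ⊗ X)_ℂ`. Strong induction on `i`: with `i + t + m = n`, `l = t + m` and
the string-top operator `T` of §2, `π_{(i,t)} = c⁻¹ · Lᵗ ∘ T ∘ (Lᵐ − Σ_{P' = (i', ·), i' < i} π_{P'} ∘ Lᵐ)` — checked
on each Lefschetz component `L^{t''} ξ`, `ξ ∈ P^{i''}`: for `i'' > i` the class `L^{m+t''} ξ` is past the top of its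
string, for `i'' < i` it is removed by `π_{(i'', m+t'')}`, for `i'' = i` it is the string top and `T` returns `c • ξ`;
dead indices (`i + t > n`) have `π_P = 0`. [cite: Andre1996Motifs, Prop. 2.2 (p. 16)]
[cite: Kleiman1968AlgebraicCycles, §1.4 (1.4.4–1.4.6)] [cite: VoisinHodgeI2002, §6.2.3 Cor. 6.26] -/
theorem internalProj_lefschetzSummand_mem_map_corrAction (μ : OrientationFamily) (hX : IsSmoothProjective n X)
    (hη : IsPolarizationClass n X η) (a : ℕ) (P : {p : ℕ × ℕ // p.1 + 2 * p.2 = a}) :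
    internalProj (isInternal_lefschetzSummand η n hη.hasHardLefschetz (fun _ hm ↦ subsingleton_complexBetti hX hm) a)
        P ∈ (motivatedClasses (n + n) (X ⊗ X) n).map (corrAction μ hX hX (rfl : a + 2 * n = a + 2 * n)) := by
  suffices h : ∀ (i a : ℕ) (P : {p : ℕ × ℕ // p.1 + 2 * p.2 = a}), P.1.1 = i →
      internalProj (isInternal_lefschetzSummand η n hη.hasHardLefschetz
          (fun _ hm ↦ subsingleton_complexBetti hX hm) a) P ∈
        (motivatedClasses (n + n) (X ⊗ X) n).map (corrAction μ hX hX (rfl : a + 2 * n = a + 2 * n)) from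
    h P.1.1 a P rfl
  intro i
  induction i using Nat.strong_induction_on with
  | _ i ih => ?_
  intro a P hPi
  classical
  have hL : HasHardLefschetzProperty η n := hη.hasHardLefschetz
  have hvan : ∀ m, 2 * n < m → Subsingleton (complexBetti X m) := fun m hm ↦ subsingleton_complexBetti hX hm
  obtain ⟨⟨i', t⟩, hP⟩ := P
  dsimp only at hPi hP
  subst hPi
  by_cases hdead : n < i' + t
  · -- a dead index: the projection vanishes
    have h0 : internalProj (isInternal_lefschetzSummand η n hL hvan a) ⟨(i', t), hP⟩ = 0 :=
      LinearMap.ext fun x ↦ internalProj_lefschetzSummand_of_lt hL hvan ⟨(i', t), hP⟩ hdead x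
    rw [h0]
    exact Submodule.zero_mem _
  push Not at hdead
  obtain ⟨m, hm⟩ : ∃ m, i' + t + m = n := ⟨n - (i' + t), by omega⟩
  -- the string-top operator for primitive degree `i'`, string length `l = t + m`, top degree `a + 2m`
  obtain ⟨T, hT, c, hc, hTc⟩ := exists_stringTop_mem_map_corrAction μ hX hη (i := i') (l := t + m)
    (a := a + 2 * m) (by omega) (by omega) (show a + 2 * m + 2 * i' = i' + 2 * n by omega)
  set F := (Finset.univ : Finset {p : ℕ × ℕ // p.1 + 2 * p.2 = a + 2 * m}).filter (fun P' ↦ P'.1.1 < i')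
    with hF
  set Lm := lefschetzPowTo η m a (a + 2 * m) rfl with hLm
  set Lt := lefschetzPowTo η t i' a hP with hLt
  set R : complexBetti X a →ₗ[ℂ] complexBetti X i' := T ∘ₗ Lm -
    ∑ P' ∈ F, T ∘ₗ (internalProj (isInternal_lefschetzSummand η n hL hvan (a + 2 * m)) P' ∘ₗ Lm) with hR
  -- membership of `c⁻¹ • Lᵗ ∘ R`
  have hR_mem : R ∈ (motivatedClasses (n + n) (X ⊗ X) (i' + m)).map
      (corrAction μ hX hX (show a + 2 * (i' + m) = i' + 2 * n by omega)) := by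
    refine Submodule.sub_mem _ ?_ (Submodule.sum_mem _ fun P' hP' ↦ ?_)
    · exact comp_lefschetzPowTo_mem_map_corrAction_motivatedClasses μ hX hX hη.mem_algebraicClasses a m rfl rfl
        (show a + 2 * m + 2 * i' = i' + 2 * n by omega) _ hT
    · have hπ := ih P'.1.1 (Finset.mem_filter.mp hP').2 (a + 2 * m) P' rfl
      have h1 := comp_lefschetzPowTo_mem_map_corrAction_motivatedClasses μ hX hX hη.mem_algebraicClasses a m
        (rfl : n + m = n + m) rfl rfl (show a + 2 * (n + m) = a + 2 * m + 2 * n by omega) hπ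
      exact comp_mem_map_corrAction_motivatedClasses μ hX hX hX (show i' + (n + m) = i' + m + n by omega)
        (show a + 2 * (n + m) = a + 2 * m + 2 * n by omega) (show a + 2 * m + 2 * i' = i' + 2 * n by omega) _
        hT h1
  have hOp_mem : c⁻¹ • (Lt ∘ₗ R) ∈ (motivatedClasses (n + n) (X ⊗ X) n).map
      (corrAction μ hX hX (rfl : a + 2 * n = a + 2 * n)) :=
    Submodule.smul_mem _ _ (lefschetzPowTo_comp_mem_map_corrAction_motivatedClasses μ hX hX
      hη.mem_algebraicClasses a i' t (show i' + m + t = n by omega) hP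
      (show a + 2 * (i' + m) = i' + 2 * n by omega) rfl hR_mem)
  refine mem_map_corrAction_motivatedClasses_of_eq μ hX hX rfl hOp_mem (LinearMap.ext fun x ↦ ?_)
  -- compare the two operators on the Lefschetz decomposition of `x`
  conv_lhs => rw [← sum_lefschetzPowTo_primitivePart hL hvan x]
  conv_rhs => rw [← sum_lefschetzPowTo_primitivePart hL hvan x]
  rw [map_sum, map_sum]
  refine Finset.sum_congr rfl fun P'' _ ↦ ?_
  obtain ⟨⟨i'', t''⟩, hP''⟩ := P''
  set ξ := primitivePart η n hL hvan ⟨(i'', t''), hP''⟩ x with hξ_def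
  have hξ : ξ ∈ primitiveClasses η n i'' := primitivePart_mem hL hvan ⟨(i'', t''), hP''⟩ x
  have hy : lefschetzPowTo η t'' i'' a hP'' ξ ∈ lefschetzSummand η n a ⟨(i'', t''), hP''⟩ :=
    lefschetzPowTo_mem_lefschetzSummand hP'' hξ
  -- `Lᵐ (L^{t''} ξ) = L^{t''+m} ξ`, in the summand of index `(i'', t'' + m)` of the top degree
  have hz_eq : Lm (lefschetzPowTo η t'' i'' a hP'' ξ) =
      lefschetzPowTo η (t'' + m) i'' (a + 2 * m) (by omega) ξ :=
    lefschetzPowTo_comp_apply η rfl hP'' rfl _ ξ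
  have hz : lefschetzPowTo η (t'' + m) i'' (a + 2 * m) (by omega) ξ ∈
      lefschetzSummand η n (a + 2 * m) ⟨(i'', t'' + m), by omega⟩ :=
    lefschetzPowTo_mem_lefschetzSummand _ hξ
  have hRy : R (lefschetzPowTo η t'' i'' a hP'' ξ) =
      T (lefschetzPowTo η (t'' + m) i'' (a + 2 * m) (by omega) ξ) -
        ∑ P' ∈ F, T (internalProj (isInternal_lefschetzSummand η n hL hvan (a + 2 * m)) P'
          (lefschetzPowTo η (t'' + m) i'' (a + 2 * m) (by omega) ξ)) := by
    simp only [hR, LinearMap.sub_apply, LinearMap.sum_apply, LinearMap.comp_apply, hz_eq]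
  rw [LinearMap.smul_apply, LinearMap.comp_apply, hRy]
  rcases lt_trichotomy i'' i' with hlt | heq | hgt
  · -- `i'' < i'`: removed by the projection of index `(i'', t'' + m)`
    have hmemF : (⟨(i'', t'' + m), by omega⟩ : {p : ℕ × ℕ // p.1 + 2 * p.2 = a + 2 * m}) ∈ F :=
      Finset.mem_filter.mpr ⟨Finset.mem_univ _, hlt⟩
    rw [Finset.sum_eq_single_of_mem _ hmemF (fun P' _ hne ↦ by
        rw [internalProj_apply_of_mem_ne _ (Ne.symm hne) hz, map_zero]),
      internalProj_apply_of_mem _ hz, sub_self, map_zero, smul_zero,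
      internalProj_apply_of_mem_ne _ _ hy]
    exact fun h ↦ absurd (congrArg (fun q : {p : ℕ × ℕ // p.1 + 2 * p.2 = a} ↦ q.1.1) h) (by
      dsimp only; omega)
  · -- `i'' = i'`: the string top
    subst heq
    obtain rfl : t'' = t := by omega
    rw [Finset.sum_eq_zero (fun P' hP' ↦ by
        rw [internalProj_apply_of_mem_ne _ ?_ hz, map_zero]
        intro h
        have h1 := (Finset.mem_filter.mp hP').2
        rw [← h] at h1
        exact lt_irrefl _ h1),
      sub_zero, hTc ξ hξ, map_smul, inv_smul_smul₀ hc, internalProj_apply_of_mem _ hy]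
  · -- `i'' > i'`: past the top of the string
    have hz0 : lefschetzPowTo η (t'' + m) i'' (a + 2 * m) (by omega) ξ = 0 :=
      lefschetzPowTo_eq_zero_of_mem_primitiveClasses hξ _ (show n + 1 ≤ i'' + (t'' + m) by omega)
    rw [internalProj_apply_of_mem_ne _ _ hy]
    · simp only [hz0, map_zero, Finset.sum_const_zero, sub_zero, smul_zero]
    · exact fun h ↦ absurd (congrArg (fun q : {p : ℕ × ℕ // p.1 + 2 * p.2 = a} ↦ q.1.1) h) (by
        dsimp only; omega)

/-! ## §4 Proposition 2.2: `*_η` is a motivated operator -/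

/-- **André 1996, Prop. 2.2 for `*_L`, on the real carriers, unconditionally**: for `X` smooth projective of
dimension `n` over `ℂ`, EVERY polarisation class `η ∈ H²(X(ℂ); ℂ)`, every orientation family `μ` and `a + b = 2n`, the
Lefschetz involution `*_η : Hᵃ(X(ℂ); ℂ) → Hᵇ(X(ℂ); ℂ)` (`lefschetzInvolution`) is `[u]_* = pr_{1*}(pr_2^*(·) ∪ u)` for
a MOTIVATED class `u ∈ A_motᵇ(X ⊗ X)_ℂ` («`*_L` est donné par une correspondance motivée»). Assembly:
`*_η = Σ_{P = (i,j)} c_P⁻¹ · Lˢ ∘ T_P ∘ Lˢ ∘ π_P` over the live Lefschetz indices of degree `a` (`i + j + s = n`; `π_P`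
motivated by §3, `T_P` the string-top operator of §2, twists by `…Operators`), since `*_η (Lʲ p) = Lˢ p` for
`p ∈ Pⁱ` (`lefschetzInvolution_lefschetzPowTo_eq`). [cite: Andre1996Motifs, Prop. 2.2 (p. 16)]
[cite: Kleiman1968AlgebraicCycles, §1.4 (1.4.4–1.4.6)] -/
theorem lefschetzInvolution_mem_map_corrAction (μ : OrientationFamily) (hX : IsSmoothProjective n X)
    (hη : IsPolarizationClass n X η) {a b : ℕ} (hab : a + b = 2 * n) :
    lefschetzInvolution hη.hasHardLefschetz hab ∈
      (motivatedClasses (n + n) (X ⊗ X) b).map (corrAction μ hX hX (show a + 2 * b = b + 2 * n by omega)) := by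
  classical
  have hL : HasHardLefschetzProperty η n := hη.hasHardLefschetz
  have hvan : ∀ m, 2 * n < m → Subsingleton (complexBetti X m) := fun m hm ↦ subsingleton_complexBetti hX hm
  -- one motivated operator per Lefschetz index of degree `a`
  have hOp : ∀ P : {p : ℕ × ℕ // p.1 + 2 * p.2 = a}, ∃ Op ∈ (motivatedClasses (n + n) (X ⊗ X) b).map
      (corrAction μ hX hX (show a + 2 * b = b + 2 * n by omega)),
      ∀ (P'' : {p : ℕ × ℕ // p.1 + 2 * p.2 = a}) (ξ : complexBetti X P''.1.1), ξ ∈ primitiveClasses η n P''.1.1 →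
        (P'' = P → Op (lefschetzPowTo η P''.1.2 P''.1.1 a P''.2 ξ) =
          lefschetzInvolution hL hab (lefschetzPowTo η P''.1.2 P''.1.1 a P''.2 ξ)) ∧
        (P'' ≠ P → Op (lefschetzPowTo η P''.1.2 P''.1.1 a P''.2 ξ) = 0) := by
    rintro ⟨⟨i, j⟩, hP⟩
    dsimp only at hP
    by_cases hdead : n < i + j
    · -- dead index: the zero operator (`Lʲ Pⁱ = 0`)
      refine ⟨0, Submodule.zero_mem _, fun P'' ξ hξ ↦ ⟨fun h ↦ ?_, fun _ ↦ rfl⟩⟩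
      subst h
      rw [LinearMap.zero_apply, lefschetzPowTo_eq_zero_of_mem_primitiveClasses hξ _ (by dsimp only; omega),
        map_zero]
    push Not at hdead
    obtain ⟨s, hs⟩ : ∃ s, i + j + s = n := ⟨n - (i + j), by omega⟩
    obtain ⟨T, hT, c, hc, hTc⟩ := exists_stringTop_mem_map_corrAction μ hX hη (i := i) (l := j + s)
      (a := a + 2 * s) (by omega) (by omega) (show a + 2 * s + 2 * i = i + 2 * n by omega)
    set π := internalProj (isInternal_lefschetzSummand η n hL hvan a) ⟨(i, j), hP⟩ with hπ
    have hπ_mem := internalProj_lefschetzSummand_mem_map_corrAction μ hX hη a ⟨(i, j), hP⟩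
    -- `Op = c⁻¹ • Lˢ ∘ T ∘ Lˢ ∘ π`
    have h1 := lefschetzPowTo_comp_mem_map_corrAction_motivatedClasses μ hX hX hη.mem_algebraicClasses a a s
      (rfl : n + s = n + s) (rfl : a + 2 * s = a + 2 * s) rfl (show a + 2 * (n + s) = a + 2 * s + 2 * n by omega)
      hπ_mem
    have h2 := comp_mem_map_corrAction_motivatedClasses μ hX hX hX (show i + (n + s) = i + s + n by omega)
      (show a + 2 * (n + s) = a + 2 * s + 2 * n by omega) (show a + 2 * s + 2 * i = i + 2 * n by omega)
      (show a + 2 * (i + s) = i + 2 * n by omega) hT h1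
    have h3 := lefschetzPowTo_comp_mem_map_corrAction_motivatedClasses μ hX hX hη.mem_algebraicClasses a i s
      (show i + s + s = b by omega) (show i + 2 * s = b by omega) (show a + 2 * (i + s) = i + 2 * n by omega)
      (show a + 2 * b = b + 2 * n by omega) h2
    refine ⟨_, Submodule.smul_mem _ c⁻¹ h3, fun P'' ξ hξ ↦ ?_⟩
    have hy : lefschetzPowTo η P''.1.2 P''.1.1 a P''.2 ξ ∈ lefschetzSummand η n a P'' :=
      lefschetzPowTo_mem_lefschetzSummand P''.2 hξ
    refine ⟨fun h ↦ ?_, fun h ↦ ?_⟩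
    · subst h
      dsimp only at ξ hξ hy ⊢
      rw [LinearMap.smul_apply, LinearMap.comp_apply, LinearMap.comp_apply, LinearMap.comp_apply,
        internalProj_apply_of_mem _ hy, lefschetzPowTo_comp_apply η rfl hP rfl (by omega : i + 2 * (j + s) = a + 2 * s) ξ,
        hTc ξ hξ, map_smul, inv_smul_smul₀ hc,
        lefschetzInvolution_lefschetzPowTo_eq hL hs hP hab (show i + 2 * s = b by omega) ξ]
    · rw [LinearMap.smul_apply, LinearMap.comp_apply, LinearMap.comp_apply, LinearMap.comp_apply,
        internalProj_apply_of_mem_ne _ h hy, map_zero, map_zero, map_zero, smul_zero]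
  choose Op hOp_mem hOp_spec using hOp
  refine mem_map_corrAction_motivatedClasses_of_eq μ hX hX _ (Submodule.sum_mem _ fun P _ ↦ hOp_mem P)
    (S := ∑ P, Op P) (LinearMap.ext fun x ↦ ?_)
  conv_lhs => rw [← sum_lefschetzPowTo_primitivePart hL hvan x]
  conv_rhs => rw [← sum_lefschetzPowTo_primitivePart hL hvan x]
  rw [map_sum, map_sum]
  refine Finset.sum_congr rfl fun P'' _ ↦ ?_
  have hξ := primitivePart_mem hL hvan P'' x
  rw [LinearMap.sum_apply, Finset.sum_eq_single_of_mem P'' (Finset.mem_univ _) (fun P _ hne ↦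
      (hOp_spec P P'' _ hξ).2 (Ne.symm hne))]
  exact (hOp_spec P'' P'' _ hξ).1 rfl

end Summit.HodgeConjecture.HodgeConjecture.Theorems

end
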